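import Summits.RiemannHypothesis.RiemannHypothesis.Theorems.PfPersistenceMarkovCoreWindowFeynmanHellmann
import Literature.NumberTheory.LFunctions.WeilArchDensityAsymptotics
import HarnessLib

/-!
# PF persistence (theory 1, edge law): THE MARKOV CORE, XVIII — SMALL WINDOWS: the universal edge
# constant `a ε′(a) → −1 = −2c₀` as `a → 0⁺`, for EVERY table

Helper file (`--supports stmt-RiemannHypothesis-19953`); mechanism/rigidity campaign; no RH claims.
Companion text `run/shared/lean/pub/pub-rhpf/pub-rhpf-theory-1/THEORY-EDGE-8.md`.

File XVI proved `HasDerivAt archBottom (archWindowResponse a / a) a` at every window, with the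
window response `archWindowResponse a = ∫₀^∞ (tρ)′(s) D_s(Φ_a) ds`.  Since a unit state of the
window `a` has `D_s = 2` for `s ≥ 4a` and `0 ≤ D_s ≤ 4` always, and since the profile `G(t) = tρ(t)`
satisfies `G(0⁺) = 1/2 = c₀` (`tendsto_mul_weilArchDensity`: the archimedean density is HALF A
LOGARITHMIC LAPLACIAN at short range) and `G(∞) = 0`, the response converges to
`2 ∫₀^∞ G′ = 2 (0 − 1/2) = −1` as the window shrinks:

* `tendsto_mul_weilArchDensity_atTop` (`G(t) → 0`), `integrableOn_weilArchVirialDensity`,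
  `integral_weilArchVirialDensity_Ioi` (`∫_δ^∞ G′ = −G(δ)`, `δ > 0`),
  `integral_weilArchVirialDensity` (`∫₀^∞ G′ = −1/2`);
* `abs_archWindowResponse_add_one_le` (`|archWindowResponse a + 1| ≤ 8 C a`);
* **`tendsto_archWindowResponse_zero`**: `archWindowResponse a → −1` as `a → 0⁺`;
  **`tendsto_mul_deriv_archBottom_zero`**: `a · ε′(a) → −1`; and for EVERY weight table `w`
  (below `½ log 2` every table is the arch-only core, file XVI):
  **`tendsto_mul_deriv_coreBottom_zero`**: `a · ∂_a coreBottom w a → −1`;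
* `eventually_deriv_archBottom_neg`: `ε′(a) < 0` at every sufficiently small window;
* `eventually_half_log_le_archBottom`, **`tendsto_archBottom_zero`**: `ε(a) + ½ log a` is
  eventually antitone, so `ε(a) ≥ ½ log (1/a) − K` near `0` and `ε(a) → +∞` as `a → 0⁺`.

So the small-window edge law is UNIVERSAL with constant `−1 = −2·edgeLawKernelConstant`: the same
for every windowed form of this type (structure of the class, not an invariant); RH-free,
arithmetic-free.

References: Kato 1966 VII §4; Bombieri 2000 §4 (the dilation); for comparison only, Chen–Weth,
arXiv:1710.03416 = Comm. PDE 44 (2019) (the logarithmic Laplacian, symbol `2 log |ζ|`, whose Dirichlet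
eigenvalues obey `λ(rΩ) = λ(Ω) − 2 log r` — the model of the `½ log (1/a)` growth; nothing of it is
used in the proofs).
-/

set_option linter.dupNamespace false

noncomputable section

open MeasureTheory Set Filter Metric
open scoped Topology

namespace Summit.RiemannHypothesis.RiemannHypothesis.Theorems.PfPersistence

open Literature.NumberTheory.LFunctions
open Summit.RiemannHypothesis.RiemannHypothesis.Theorems.WeilWindowFlowWindowLipschitz
  (stub_barrierEnergy_weilIncrement_le_four stub_localizedCut_weilIncrement_eq_two_mul
    stub_localizedCut_aesm_weilIncrement)

variable {a : ℝ}

/-! ## §1 The profile `G(t) = tρ(t)`: limits at `0⁺` and `∞`, the total integral of `G′` -/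

/-- `G(t) = tρ(t) → 0` as `t → ∞` (`0 ≤ G(t) ≤ K e^{-t/4}`). [cite: Bombieri2000Weil, Thm 2 (p. 193)] -/
theorem tendsto_mul_weilArchDensity_atTop :
    Tendsto (fun t : ℝ ↦ t * weilArchDensity t) atTop (𝓝 0) := by
  set K : ℝ := Real.exp (3 * 1 / 2) / 2 + 4 / (1 - Real.exp (-(4 * 1))) with hK
  have h4 : Tendsto (fun t : ℝ ↦ K * Real.exp (-(t / 4))) atTop (𝓝 0) := by
    have h := Real.tendsto_exp_neg_atTop_nhds_zero.comp
      (tendsto_id.atTop_div_const (show (0 : ℝ) < 4 by norm_num))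
    simpa [Function.comp_def] using h.const_mul K
  refine tendsto_of_tendsto_of_tendsto_of_le_of_le' tendsto_const_nhds h4 ?_ ?_
  · filter_upwards [eventually_gt_atTop 0] with t ht
    exact mul_nonneg ht.le (weilArchDensity_pos ht).le
  · filter_upwards [eventually_gt_atTop 0] with t ht
    exact mul_weilArchDensity_le_exp_neg one_pos ht

/-- `G′ = weilArchVirialDensity` is integrable on `(δ, ∞)` for `δ ≥ 0` (`|G′| ≤ C e^{-t/4}`).
[folklore] -/
theorem integrableOn_weilArchVirialDensity {δ : ℝ} (hδ : 0 ≤ δ) :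
    IntegrableOn weilArchVirialDensity (Ioi δ) := by
  have hdom : IntegrableOn (fun s ↦ archVirialConst * Real.exp (-(1 / 4) * s)) (Ioi δ) :=
    (exp_neg_integrableOn_Ioi δ (by norm_num : (0 : ℝ) < 1 / 4)).const_mul _
  refine hdom.mono' measurable_weilArchVirialDensity.aestronglyMeasurable.restrict ?_
  refine (ae_restrict_iff' measurableSet_Ioi).2 (Eventually.of_forall fun s hs ↦ ?_)
  have hs0 : (0 : ℝ) < s := hδ.trans_lt hs
  rw [Real.norm_eq_abs]
  convert abs_weilArchVirialDensity_le_archVirialConst hs0 using 2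
  ring_nf

/-- `∫_δ^∞ G′ = −G(δ)` for `δ > 0` (FTC on `(δ, ∞)`, `G(∞) = 0`). [folklore] -/
theorem integral_weilArchVirialDensity_Ioi {δ : ℝ} (hδ : 0 < δ) :
    ∫ s in Ioi δ, weilArchVirialDensity s = -(δ * weilArchDensity δ) := by
  rw [integral_Ioi_of_hasDerivAt_of_tendsto (f := fun t : ℝ ↦ t * weilArchDensity t)
    (hasDerivAt_mul_weilArchDensity hδ).continuousAt.continuousWithinAt
    (fun x hx ↦ hasDerivAt_mul_weilArchDensity (hδ.trans hx))
    (integrableOn_weilArchVirialDensity hδ.le) tendsto_mul_weilArchDensity_atTop]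
  ring

/-- **`∫₀^∞ (tρ)′ = −1/2 = −c₀`**: the profile `G = tρ` falls from `G(0⁺) = 1/2`
(`tendsto_mul_weilArchDensity`) to `G(∞) = 0`. [cite: Bombieri2000Weil, Thm 2 (p. 193)] -/
theorem integral_weilArchVirialDensity :
    ∫ s in Ioi (0 : ℝ), weilArchVirialDensity s = -(1 / 2) := by
  -- extend `G` by its limit `1/2` at `0`
  set G : ℝ → ℝ := fun t ↦ if t = 0 then 1 / 2 else t * weilArchDensity t with hG
  have hGeq : ∀ t, t ≠ 0 → G t = t * weilArchDensity t := fun t ht ↦ by simp [hG, ht]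
  have hcont : ContinuousWithinAt G (Ici 0) 0 := by
    rw [← continuousWithinAt_Ioi_iff_Ici, ContinuousWithinAt]
    have h0 : G 0 = 1 / 2 := by simp [hG]
    rw [h0]
    refine Filter.Tendsto.congr' ?_ tendsto_mul_weilArchDensity
    filter_upwards [self_mem_nhdsWithin] with t ht
    exact (hGeq t (ne_of_gt ht)).symm
  have hderiv : ∀ x ∈ Ioi (0 : ℝ), HasDerivAt G (weilArchVirialDensity x) x := by
    intro x hx
    have hx0 : (0 : ℝ) < x := hx
    refine (hasDerivAt_mul_weilArchDensity hx0).congr_of_eventuallyEq ?_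
    filter_upwards [isOpen_Ioi.mem_nhds hx0] with t ht
    exact hGeq t (ne_of_gt ht)
  have hlim : Tendsto G atTop (𝓝 0) := by
    refine tendsto_mul_weilArchDensity_atTop.congr' ?_
    filter_upwards [eventually_gt_atTop 0] with t ht
    exact (hGeq t ht.ne').symm
  rw [integral_Ioi_of_hasDerivAt_of_tendsto hcont hderiv (integrableOn_weilArchVirialDensity le_rfl)
    hlim]
  simp [hG]

/-! ## §2 The response at small windows -/

/-- `s ↦ G′(s) D_s(u)` is integrable on `(0, ∞)` for `u ∈ L²`. [folklore] -/
theorem integrableOn_weilArchVirialDensity_mul_weilIncrement {u : ℝ → ℂ} (hu : MemLp u 2) :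
    IntegrableOn (fun s ↦ weilArchVirialDensity s * weilIncrement u s) (Ioi 0) := by
  set N : ℝ := ∫ x, ‖u x‖ ^ 2
  have hdom : IntegrableOn (fun s ↦ archVirialConst * Real.exp (-(1 / 4) * s) * (4 * N)) (Ioi 0) :=
    ((exp_neg_integrableOn_Ioi 0 (by norm_num : (0 : ℝ) < 1 / 4)).const_mul _).mul_const _
  refine hdom.mono' ?_ ?_
  · exact (measurable_weilArchVirialDensity.aestronglyMeasurable.mul
      (stub_localizedCut_aesm_weilIncrement hu.1)).restrict
  · refine (ae_restrict_iff' measurableSet_Ioi).2 (Eventually.of_forall fun s hs ↦ ?_)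
    have hs0 : (0 : ℝ) < s := hs
    rw [Real.norm_eq_abs, abs_mul, abs_of_nonneg (weilIncrement_nonneg u s)]
    have hb : |weilArchVirialDensity s| ≤ archVirialConst * Real.exp (-(1 / 4) * s) := by
      convert abs_weilArchVirialDensity_le_archVirialConst hs0 using 2
      ring_nf
    exact mul_le_mul hb (stub_barrierEnergy_weilIncrement_le_four hu s) (weilIncrement_nonneg u s)
      (mul_nonneg archVirialConst_pos.le (Real.exp_pos _).le)

/-- **SMALL-WINDOW ESTIMATE**: `|archWindowResponse a + 1| ≤ 8 C a` for every `a > 0`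
(`C = archVirialConst`): a unit state of the window `a` has `D_s = 2` for `s ≥ 4a`, `0 ≤ D_s ≤ 4`,
and `2 ∫₀^∞ G′ = −1`. [cite: Kato1966, VII §4] -/
theorem abs_archWindowResponse_add_one_le (ha : 0 < a) :
    |archWindowResponse a + 1| ≤ 8 * archVirialConst * a := by
  obtain ⟨u, hu⟩ := exists_isCoreGround (archOnly_nonneg a) ha
  have huL : MemLp u 2 := hu.1.1
  have hun : ∫ x, ‖u x‖ ^ 2 = (1 : ℝ) := hu.2.1
  have hI1 := integrableOn_weilArchVirialDensity_mul_weilIncrement huL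
  have hI2 : IntegrableOn (fun s ↦ weilArchVirialDensity s * 2) (Ioi 0) :=
    (integrableOn_weilArchVirialDensity le_rfl).mul_const _
  have htwo : ∫ s in Ioi (0 : ℝ), weilArchVirialDensity s * 2 = -1 := by
    rw [integral_mul_const, integral_weilArchVirialDensity]
    norm_num
  have hsplit : archWindowResponse a + 1 =
      ∫ s in Ioi (0 : ℝ), weilArchVirialDensity s * (weilIncrement u s - 2) := by
    have h1 : archWindowResponse a + 1 =
        archWindowResponse a - ∫ s in Ioi (0 : ℝ), weilArchVirialDensity s * 2 := by
      rw [htwo]; ring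
    rw [h1, archWindowResponse_eq ha hu, ← integral_sub hI1 hI2]
    congr 1
    ext s
    ring
  -- the integrand vanishes for `s ≥ 4a` and is bounded by `2C` below
  have hsupp : ∀ x, 2 * a ≤ |x| → u x = 0 := fun x hx ↦
    hu.1.2.1 x fun hI ↦ by
      have := abs_le.2 ⟨by linarith [hI.1], hI.2⟩
      linarith
  have hD2 : ∀ s, 4 * a ≤ s → weilIncrement u s = 2 := fun s hs ↦ by
    rw [stub_localizedCut_weilIncrement_eq_two_mul huL hsupp (by linarith), hun, mul_one]
  have hbound : ∀ᵐ s ∂(volume.restrict (Ioi (0 : ℝ))),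
      ‖weilArchVirialDensity s * (weilIncrement u s - 2)‖ ≤
        (Iic (4 * a)).indicator (fun _ ↦ 2 * archVirialConst) s := by
    refine (ae_restrict_iff' measurableSet_Ioi).2 (Eventually.of_forall fun s hs ↦ ?_)
    have hs0 : (0 : ℝ) < s := hs
    by_cases h4 : s ≤ 4 * a
    · rw [indicator_of_mem (show s ∈ Iic (4 * a) from h4), norm_mul, Real.norm_eq_abs,
        Real.norm_eq_abs]
      have h1 : |weilArchVirialDensity s| ≤ archVirialConst := by
        refine (abs_weilArchVirialDensity_le_archVirialConst hs0).trans ?_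
        have : Real.exp (-(s / 4)) ≤ 1 := Real.exp_le_one_iff.2 (by linarith)
        nlinarith [archVirialConst_pos]
      have h2 : |weilIncrement u s - 2| ≤ 2 := by
        have h0 := weilIncrement_nonneg u s
        have h4' : weilIncrement u s ≤ 4 := by
          have h := stub_barrierEnergy_weilIncrement_le_four huL s
          rwa [hun, mul_one] at h
        rw [abs_le]
        constructor <;> linarith
      calc |weilArchVirialDensity s| * |weilIncrement u s - 2| ≤ archVirialConst * 2 :=
            mul_le_mul h1 h2 (abs_nonneg _) archVirialConst_pos.le
        _ = 2 * archVirialConst := by ring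
    · rw [indicator_of_notMem (show s ∉ Iic (4 * a) from h4), hD2 s (le_of_not_ge h4)]
      simp
  have hg : Integrable ((Iic (4 * a)).indicator fun _ ↦ 2 * archVirialConst)
      (volume.restrict (Ioi (0 : ℝ))) := by
    rw [integrable_indicator_iff measurableSet_Iic]
    refine integrableOn_const ?_
    rw [Measure.restrict_apply measurableSet_Iic, Iic_inter_Ioi, Real.volume_Ioc]
    exact ENNReal.ofReal_ne_top
  have hle := norm_integral_le_of_norm_le hg hbound
  rw [hsplit, ← Real.norm_eq_abs]
  refine hle.trans (le_of_eq ?_)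
  rw [setIntegral_indicator measurableSet_Iic, setIntegral_const, Ioi_inter_Iic,
    Real.volume_real_Ioc, smul_eq_mul, max_eq_left (by linarith)]
  ring

/-! ## §3 The universal small-window edge constant -/

/-- **`archWindowResponse a → −1` as `a → 0⁺`.** [cite: Kato1966, VII §4] -/
theorem tendsto_archWindowResponse_zero :
    Tendsto archWindowResponse (𝓝[>] 0) (𝓝 (-1)) := by
  rw [Metric.tendsto_nhdsWithin_nhds]
  intro ε hε
  have hC := archVirialConst_pos
  have hC1 : (0 : ℝ) < 8 * archVirialConst + 1 := by linarith
  refine ⟨ε / (8 * archVirialConst + 1), div_pos hε hC1, fun {a} ha hd ↦ ?_⟩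
  have ha0 : (0 : ℝ) < a := ha
  rw [Real.dist_eq, sub_neg_eq_add]
  rw [Real.dist_eq, sub_zero, abs_of_pos ha0] at hd
  calc |archWindowResponse a + 1| ≤ 8 * archVirialConst * a := abs_archWindowResponse_add_one_le ha0
    _ < 8 * archVirialConst * (ε / (8 * archVirialConst + 1)) +
          1 * (ε / (8 * archVirialConst + 1)) := by
        nlinarith [div_pos hε hC1]
    _ = ε := by rw [← add_mul, mul_div_cancel₀ _ hC1.ne']

/-- **`a · ε′(a) → −1` as `a → 0⁺`** for the arch-only bottom `ε = archBottom`: the small-window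
edge law is universal with constant `−1 = −2·edgeLawKernelConstant`. [cite: Kato1966, VII §4] -/
theorem tendsto_mul_deriv_archBottom_zero :
    Tendsto (fun a ↦ a * deriv archBottom a) (𝓝[>] 0) (𝓝 (-1)) := by
  refine tendsto_archWindowResponse_zero.congr' ?_
  filter_upwards [self_mem_nhdsWithin] with a ha
  have ha0 : (0 : ℝ) < a := ha
  rw [(hasDerivAt_archBottom ha0).deriv, mul_div_cancel₀ _ ha0.ne']

/-- **For EVERY weight table** `w`: `a · ∂_a coreBottom w a → −1` as `a → 0⁺` (below `½ log 2`
every table is the arch-only core, file XVI). [cite: Kato1966, VII §4] -/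
theorem tendsto_mul_deriv_coreBottom_zero (w : ℕ → ℝ) :
    Tendsto (fun a ↦ a * deriv (coreBottom w) a) (𝓝[>] 0) (𝓝 (-1)) := by
  refine tendsto_archWindowResponse_zero.congr' ?_
  have h2 : (0 : ℝ) < Real.log 2 / 2 := div_pos (Real.log_pos one_lt_two) two_pos
  filter_upwards [self_mem_nhdsWithin, nhdsWithin_le_nhds (Iio_mem_nhds h2)] with a ha ha2
  have ha0 : (0 : ℝ) < a := ha
  rw [(hasDerivAt_coreBottom_of_lt_half_log_two w ha0 ha2).deriv, mul_div_cancel₀ _ ha0.ne']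

/-- At every sufficiently small window the response is NEGATIVE: `archWindowResponse a < 0`.
[cite: Kato1966, VII §4] -/
theorem eventually_archWindowResponse_neg : ∀ᶠ a in 𝓝[>] (0 : ℝ), archWindowResponse a < 0 :=
  tendsto_archWindowResponse_zero.eventually (Iio_mem_nhds (by norm_num))

/-- At every sufficiently small window `ε′(a) < 0` (indeed `a ε′(a) < −1/2`). [cite: Kato1966, VII §4] -/
theorem eventually_deriv_archBottom_neg : ∀ᶠ a in 𝓝[>] (0 : ℝ), deriv archBottom a < 0 := by
  filter_upwards [tendsto_mul_deriv_archBottom_zero.eventually (Iio_mem_nhds (by norm_num :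
    (-1 : ℝ) < -(1 / 2))), self_mem_nhdsWithin] with a ha ha0
  have ha0' : (0 : ℝ) < a := ha0
  by_contra h
  have : 0 ≤ a * deriv archBottom a := mul_nonneg ha0'.le (not_lt.1 h)
  linarith

/-! ## §4 `ε(a) → +∞` like `½ log (1/a)` as the window shrinks -/

/-- There is `a₀ > 0` such that `a ↦ archBottom a + ½ log a` is ANTITONE on `(0, a₀]`
(its derivative `(a ε′(a) + ½)/a` is negative there). [cite: Kato1966, VII §4] -/
theorem exists_antitoneOn_archBottom_add_half_log :
    ∃ a₀ : ℝ, 0 < a₀ ∧ AntitoneOn (fun a ↦ archBottom a + 1 / 2 * Real.log a) (Ioc 0 a₀) := by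
  have hev : ∀ᶠ a in 𝓝[>] (0 : ℝ), a * deriv archBottom a < -(1 / 2) :=
    tendsto_mul_deriv_archBottom_zero.eventually (Iio_mem_nhds (by norm_num))
  obtain ⟨a₀, ha₀, h⟩ := (nhdsGT_basis (0 : ℝ)).eventually_iff.1 hev
  refine ⟨a₀ / 2, by positivity, ?_⟩
  have hsub : Ioc 0 (a₀ / 2) ⊆ Ioi 0 := fun x hx ↦ hx.1
  have hd : ∀ x ∈ Ioc 0 (a₀ / 2),
      HasDerivAt (fun a ↦ archBottom a + 1 / 2 * Real.log a)
        (archWindowResponse x / x + 1 / 2 * x⁻¹) x := fun x hx ↦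
    (hasDerivAt_archBottom hx.1).add ((Real.hasDerivAt_log hx.1.ne').const_mul _)
  refine antitoneOn_of_deriv_nonpos (convex_Ioc 0 (a₀ / 2)) ?_ ?_ ?_
  · exact fun x hx ↦ (hd x hx).continuousAt.continuousWithinAt
  · intro x hx
    exact (hd x (interior_subset hx)).differentiableAt.differentiableWithinAt
  · intro x hx
    have hx' : x ∈ Ioc 0 (a₀ / 2) := interior_subset hx
    have hx0 : 0 < x := hx'.1
    rw [(hd x hx').deriv]
    have h1 : x * deriv archBottom x < -(1 / 2) := h ⟨hx0, by linarith [hx'.2]⟩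
    rw [(hasDerivAt_archBottom hx0).deriv] at h1
    have h2 : archWindowResponse x < -(1 / 2) := by rwa [mul_div_cancel₀ _ hx0.ne'] at h1
    have : archWindowResponse x / x + 1 / 2 * x⁻¹ = (archWindowResponse x + 1 / 2) / x := by
      field_simp
    rw [this]
    exact div_nonpos_of_nonpos_of_nonneg (by linarith) hx0.le

/-- **Logarithmic lower bound at small windows**: there are `a₀ > 0` and `K` with
`½ log (1/a) − K ≤ archBottom a` for all `0 < a ≤ a₀`. [cite: Kato1966, VII §4] -/
theorem eventually_half_log_le_archBottom :
    ∃ a₀ K : ℝ, 0 < a₀ ∧ ∀ a, 0 < a → a ≤ a₀ → 1 / 2 * Real.log (1 / a) - K ≤ archBottom a := by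
  obtain ⟨a₀, ha₀, hanti⟩ := exists_antitoneOn_archBottom_add_half_log
  refine ⟨a₀, -(archBottom a₀ + 1 / 2 * Real.log a₀), ha₀, fun a ha haa ↦ ?_⟩
  have h := hanti ⟨ha, haa⟩ ⟨ha₀, le_rfl⟩ haa
  simp only at h
  have hl : Real.log (1 / a) = -Real.log a := by rw [one_div, Real.log_inv]
  rw [hl]
  linarith

/-- **`ε(a) → +∞` as the window shrinks** (`archBottom a ≥ ½ log(1/a) − K`).
[cite: Kato1966, VII §4] -/
theorem tendsto_archBottom_zero : Tendsto archBottom (𝓝[>] 0) atTop := by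
  obtain ⟨a₀, K, ha₀, h⟩ := eventually_half_log_le_archBottom
  have hlog : Tendsto (fun a : ℝ ↦ 1 / 2 * Real.log (1 / a) - K) (𝓝[>] 0) atTop := by
    have h1 : Tendsto (fun a : ℝ ↦ Real.log (1 / a)) (𝓝[>] 0) atTop := by
      simpa only [one_div, Function.comp_def] using
        Real.tendsto_log_atTop.comp tendsto_inv_nhdsGT_zero
    exact ((h1.const_mul_atTop (by norm_num : (0 : ℝ) < 1 / 2)).atTop_add
      (tendsto_const_nhds (x := -K))).congr fun a ↦ by ring
  refine tendsto_atTop_mono' _ ?_ hlog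
  filter_upwards [self_mem_nhdsWithin, nhdsWithin_le_nhds (Iic_mem_nhds ha₀)] with a ha haa
  exact h a ha haa

/-- For EVERY weight table: `coreBottom w a → +∞` as `a → 0⁺` (below `½ log 2` every table is the
arch-only core, file XVI). [cite: Kato1966, VII §4] -/
theorem tendsto_coreBottom_zero (w : ℕ → ℝ) : Tendsto (coreBottom w) (𝓝[>] 0) atTop := by
  refine tendsto_archBottom_zero.congr' ?_
  have h2 : (0 : ℝ) < Real.log 2 / 2 := div_pos (Real.log_pos one_lt_two) two_pos
  filter_upwards [nhdsWithin_le_nhds (Iio_mem_nhds h2)] with a ha2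
  exact (coreBottom_of_lt_half_log_two w ha2).symm

end Summit.RiemannHypothesis.RiemannHypothesis.Theorems.PfPersistence

end
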